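import Mathlib
import HarnessLib

/-!
# The POINTWISE obligation (P) of the blow-up shell: one-variable Taylor at a minimum, `g(t)/t² → g″(0)/2`, and the threshold form
# (free-hands support of ⟨stmt-QuantumFields-24197⟩ `SwapVirialDeficit.SwapGluedStiffness`; companion of ✓`BlowUp.smallBall_limit_of_blowUp`)

In the joint blow-up of the ring deficit (massive-mode rung for the principal σ-sector law of `F^S_{000}`), a point `x` of the blow-up space
and a scale `t = √u` give a ring history `Φ_t x`, smooth in `t`, with `Φ_0 x` σ-flat; the blown-up event is `{x | F(Φ_{√u} x) ≤ r·u}`.  Since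
`F ≥ 0` vanishes on flat histories, `g := t ↦ F(Φ_t x)` has a minimum `g(0) = 0`, so `g(t)/t² → g″(0)/2 =: G x` and, off the level `G x = r`,
EVENTUALLY `x ∈ E r u ↔ G x < r` — hypothesis (P) of ✓`BlowUp.tendsto_smallBall_div_rpow_of_good` with `Dom₀ = univ` on the chart.  This file
is that calculus, once:

* §1 ★★ `tendsto_div_sq_of_hasDerivAt` — `g 0 = 0`, `g ≥ 0` near `0`, `g` differentiable near `0` with `g′` differentiable at `0`
  ⟹ `g t / t² → g″(0)/2` along `𝓝[≠] 0` (local minimum ⟹ `g′(0) = 0`, then l'Hôpital ✓`HasDerivAt.lhopital_zero_nhdsNE` + the slope of `g′`);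
  `tendsto_div_sq_of_contDiffAt` — the same from `ContDiffAt ℝ 2 g 0`, limit `deriv (deriv g) 0 / 2`;
* §2 ★ `eventually_le_mul_sq_iff` — if `g t/t² → q` (`t → 0⁺`) and `q ≠ r` then eventually `g t ≤ r·t² ↔ q < r`;
  ★ `eventually_sqrt_le_mul_iff` — the same at `t = √u`: eventually in `u → 0⁺`, `g(√u) ≤ r·u ↔ q < r`.

HONEST LABEL: one-variable real analysis (plan-level plumbing); NOT the fixed-`L` sharp law, NOT ⟨24197⟩; the Yang–Mills mass gap is NOT proved;
no summit is proved by a line.  Seat ym-line-fcl-p3 g45 (cell ym-idea-1, free hands; item of record ⟨24085⟩ aside, untouched),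
`--supports stmt-QuantumFields-24197`.  THEOREMS ONLY (0 `def`, 0 `sorry`), standard axioms.  References: [folklore].
-/

set_option autoImplicit false

noncomputable section

open Set Filter Topology

namespace Summit.QuantumFields.YangMills.Theorems.SwapVirialDeficit.BlowUp

/-! ## §1 `g(t)/t² → g″(0)/2` at a minimum -/

/-- ★★ **Second-order Taylor quotient at a minimum**: if `g 0 = 0`, `0 ≤ g` near `0`, `g` has derivative `g′` near `0` and `g′` has derivative
`q₂` at `0`, then `g t / t² → q₂ / 2` as `t → 0`, `t ≠ 0` (the minimum forces `g′ 0 = 0`; l'Hôpital once, then the difference quotient of `g′`).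
[folklore] -/
theorem tendsto_div_sq_of_hasDerivAt {g g' : ℝ → ℝ} {q₂ : ℝ} (h0 : g 0 = 0) (hmin : ∀ᶠ t in 𝓝 (0 : ℝ), 0 ≤ g t)
    (h1 : ∀ᶠ t in 𝓝 (0 : ℝ), HasDerivAt g (g' t) t) (h2 : HasDerivAt g' q₂ 0) :
    Tendsto (fun t : ℝ => g t / t ^ 2) (𝓝[≠] (0 : ℝ)) (𝓝 (q₂ / 2)) := by
  -- the minimum forces `g′(0) = 0`
  have hloc : IsLocalMin g 0 := by
    filter_upwards [hmin] with t ht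
    rw [h0]; exact ht
  have hg'0 : g' 0 = 0 := hloc.hasDerivAt_eq_zero h1.self_of_nhds
  -- l'Hôpital with denominator `t²`
  have hff' : ∀ᶠ t in 𝓝[≠] (0 : ℝ), HasDerivAt g (g' t) t := h1.filter_mono nhdsWithin_le_nhds
  have hgg' : ∀ᶠ t in 𝓝[≠] (0 : ℝ), HasDerivAt (fun t : ℝ => t ^ 2) (2 * t) t :=
    Eventually.of_forall fun t => by simpa using hasDerivAt_pow 2 t
  have hne : ∀ᶠ t in 𝓝[≠] (0 : ℝ), 2 * t ≠ 0 := by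
    filter_upwards [self_mem_nhdsWithin] with t ht
    exact mul_ne_zero two_ne_zero ht
  have hfa : Tendsto g (𝓝[≠] (0 : ℝ)) (𝓝 0) := by
    have hc : Tendsto g (𝓝 (0 : ℝ)) (𝓝 (g 0)) := h1.self_of_nhds.continuousAt.tendsto
    rw [h0] at hc
    exact hc.mono_left nhdsWithin_le_nhds
  have hga : Tendsto (fun t : ℝ => t ^ 2) (𝓝[≠] (0 : ℝ)) (𝓝 0) := by
    have hc := (continuous_pow 2).tendsto (0 : ℝ)
    rw [zero_pow two_ne_zero] at hc
    exact hc.mono_left nhdsWithin_le_nhds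
  have hdiv : Tendsto (fun t : ℝ => g' t / (2 * t)) (𝓝[≠] (0 : ℝ)) (𝓝 (q₂ / 2)) := by
    have hs := h2.tendsto_slope_zero
    simp only [zero_add, hg'0, sub_zero, smul_eq_mul] at hs
    refine (hs.div_const 2).congr' ?_
    filter_upwards [self_mem_nhdsWithin] with t ht
    have ht' : (t : ℝ) ≠ 0 := ht
    field_simp
  exact HasDerivAt.lhopital_zero_nhdsNE hff' hgg' hne hfa hga hdiv

/-- ★★ **The `C²` form**: if `g` is `C²` at `0`, `g 0 = 0` and `0 ≤ g` near `0`, then `g t / t² → (deriv (deriv g) 0)/2` as `t → 0`, `t ≠ 0`.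
[folklore] -/
theorem tendsto_div_sq_of_contDiffAt {g : ℝ → ℝ} (hg : ContDiffAt ℝ 2 g 0) (h0 : g 0 = 0) (hmin : ∀ᶠ t in 𝓝 (0 : ℝ), 0 ≤ g t) :
    Tendsto (fun t : ℝ => g t / t ^ 2) (𝓝[≠] (0 : ℝ)) (𝓝 (deriv (deriv g) 0 / 2)) := by
  -- `g` is differentiable near `0`
  have h1 : ∀ᶠ t in 𝓝 (0 : ℝ), HasDerivAt g (deriv g t) t := by
    filter_upwards [hg.eventually (by simp)] with t ht
    exact (ht.differentiableAt (by simp)).hasDerivAt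
  -- `g′ = deriv g` is differentiable at `0`
  have hfd : ContDiffAt ℝ 1 (fderiv ℝ g) 0 := hg.fderiv_right (by norm_num)
  have hd : DifferentiableAt ℝ (fderiv ℝ g) 0 := hfd.differentiableAt (by simp)
  have hd' : DifferentiableAt ℝ (fun y => fderiv ℝ g y (1 : ℝ)) 0 :=
    ((ContinuousLinearMap.apply ℝ ℝ (1 : ℝ)).differentiableAt).comp 0 hd
  have hderiv : (fun y => fderiv ℝ g y (1 : ℝ)) = deriv g := by
    funext y; rfl
  rw [hderiv] at hd'
  exact tendsto_div_sq_of_hasDerivAt h0 hmin h1 hd'.hasDerivAt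

/-- The right-sided forms (`t → 0⁺`). [folklore] -/
theorem tendsto_div_sq_nhdsGT_of_hasDerivAt {g g' : ℝ → ℝ} {q₂ : ℝ} (h0 : g 0 = 0) (hmin : ∀ᶠ t in 𝓝 (0 : ℝ), 0 ≤ g t)
    (h1 : ∀ᶠ t in 𝓝 (0 : ℝ), HasDerivAt g (g' t) t) (h2 : HasDerivAt g' q₂ 0) :
    Tendsto (fun t : ℝ => g t / t ^ 2) (𝓝[>] (0 : ℝ)) (𝓝 (q₂ / 2)) :=
  (tendsto_div_sq_of_hasDerivAt h0 hmin h1 h2).mono_left (nhdsWithin_mono _ fun _ ht => ne_of_gt ht)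

/-! ## §2 The threshold form -/

/-- ★ **Eventual membership off the level**: if `g t / t² → q` as `t → 0⁺` and `q ≠ r`, then for all small `t > 0`,
`g t ≤ r·t² ↔ q < r`. [folklore] -/
theorem eventually_le_mul_sq_iff {g : ℝ → ℝ} {q r : ℝ} (hg : Tendsto (fun t : ℝ => g t / t ^ 2) (𝓝[>] (0 : ℝ)) (𝓝 q))
    (hqr : q ≠ r) :
    ∀ᶠ t in 𝓝[>] (0 : ℝ), (g t ≤ r * t ^ 2 ↔ q < r) := by
  rcases lt_or_gt_of_ne hqr with h | h
  · filter_upwards [hg.eventually (Iio_mem_nhds h), self_mem_nhdsWithin] with t ht ht0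
    have ht0' : (0 : ℝ) < t := ht0
    have ht2 : 0 < t ^ 2 := by positivity
    have hlt : g t / t ^ 2 < r := ht
    refine ⟨fun _ => h, fun _ => ?_⟩
    exact ((div_lt_iff₀ ht2).1 hlt).le
  · filter_upwards [hg.eventually (Ioi_mem_nhds h), self_mem_nhdsWithin] with t ht ht0
    have ht0' : (0 : ℝ) < t := ht0
    have ht2 : 0 < t ^ 2 := by positivity
    have hgt : r < g t / t ^ 2 := ht
    refine ⟨fun hle => ?_, fun hlt => absurd hlt (not_lt.2 h.le)⟩
    have := (lt_div_iff₀ ht2).1 hgt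
    linarith

/-- ★ **The same at `t = √u`**: if `g t / t² → q` as `t → 0⁺` and `q ≠ r`, then for all small `u > 0`, `g(√u) ≤ r·u ↔ q < r`
(the blown-up event of the shell is indexed by `u = t²`). [folklore] -/
theorem eventually_sqrt_le_mul_iff {g : ℝ → ℝ} {q r : ℝ} (hg : Tendsto (fun t : ℝ => g t / t ^ 2) (𝓝[>] (0 : ℝ)) (𝓝 q))
    (hqr : q ≠ r) :
    ∀ᶠ u in 𝓝[>] (0 : ℝ), (g (Real.sqrt u) ≤ r * u ↔ q < r) := by
  have hsqrt : Tendsto Real.sqrt (𝓝[>] (0 : ℝ)) (𝓝[>] (0 : ℝ)) := by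
    refine tendsto_nhdsWithin_iff.2 ⟨?_, ?_⟩
    · have h := (Real.continuous_sqrt.tendsto (0 : ℝ)).mono_left (nhdsWithin_le_nhds (s := Ioi (0 : ℝ)))
      rwa [Real.sqrt_zero] at h
    · filter_upwards [self_mem_nhdsWithin] with u hu using Real.sqrt_pos.2 hu
  filter_upwards [hsqrt.eventually (eventually_le_mul_sq_iff hg hqr), self_mem_nhdsWithin] with u hu hu0
  have hu0' : (0 : ℝ) < u := hu0
  rwa [Real.sq_sqrt hu0'.le] at hu

end Summit.QuantumFields.YangMills.Theorems.SwapVirialDeficit.BlowUp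

end
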